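import Summits.NavierStokesRegularity.NavierStokesRegularity.Theses.TerminalTrace
import Literature.Analysis.FluidPDE.LocalTypeI
import HarnessLib

/-!
# Census of Stub C of crux `TypeITraceScarL3` (stmt-NavierStokesRegularity-18385), core clauses:
# every counterexample to Stub C is a local Type-I singularity (Albritton–Barker 2019, Thm 1.1, first bullet)

Negative-lane helper of the disprover seat `cdisprove-stmt-NavierStokesRegularity-18385` (`--supports` the item;
crux work file `Cruxes/TypeITraceScarL3/Disproof.lean`, where the statement of Stub C is the `def StubC`).  Line
`apex-dichotomy` (skeleton sha16 95aa062ef93d7802): after Stubs 1, 2′, B (p576636, p583907, p585263) and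
`typeITraceScarL3_of_no_spreadExtinctApex` (p585751) the item is the statement of `stub_no_spreadExtinctApex`
(seven clauses (sw),(G),(I),(D),(R),(T),(S) ⇒ the origin is not backward singular).

LOAD-BEARING CENSUS, core part (theorems only, no definitions).  The clauses (sw) «suitable weak in `Q(1)`»,
(G) «weak gradient on `Q(1)`», (I) «`𝐈(Q(1)) ≤ M`» together with a backward-singular origin are, by definition, a
local Type-I singularity in the sense of Albritton–Barker 2019 (Thm 1.1, first bullet; tree
`LocalTypeISingularityExists`, an OPEN existence question, empty under the Liouville conjecture (L) of KNSS 2009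
by `LiouvilleExcludesLocalTypeI`).  Hence:

* `localTypeISingularityExists_of_singular_apexCore` — (sw),(G),(I) at scale `1` + singular origin ⇒
  `LocalTypeISingularityExists`: ANY counterexample to Stub C, or to Stub C with any of the clauses (D) pressure
  bound, (R) rate, (T) weakly null top, (S) spread, or the scales `a ≠ 1`, DROPPED, is a local Type-I
  singularity;
* `no_spreadExtinctApex_of_not_localTypeISingularityExists` — contrapositive packaging: the statement of Stub C
  (verbatim) follows from `¬ LocalTypeISingularityExists` (sharper than «(L) ⇒ Stub C»,
  `no_spreadExtinctApex_of_liouvilleConjectureNS` of p585751, as (L) ⇒ ¬`LocalTypeISingularityExists`).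

So no `stub_no_spreadExtinctApex_false_without_<H>` with `H ∈ {D, R, T, S}` can be landed without exhibiting a
Type-I singularity of a suitable weak solution (thereby refuting (L)): these clauses are «load-bearing at most
modulo an open problem».  (The Navier–Stokes clause (sw) IS load-bearing outright — kinematic spread witness,
separate file of the seat.)  WHAT THIS IS NOT: not Stub C, not NS regularity (neither proved nor refuted here).
References: D. Albritton, T. Barker, Arch. Ration. Mech. Anal. 232 (2019), Thm 1.1, Def. 2.1
[AlbrittonBarker2019]; G. Koch, N. Nadirashvili, G. Seregin, V. Šverák, Acta Math. 203 (2009) [KNSS2009].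
-/

noncomputable section

set_option linter.dupNamespace false

namespace Summit.NavierStokesRegularity.NavierStokesRegularity.Theorems.TypeITraceScarL3.Negative

open MeasureTheory Set Function Filter Topology Metric TopologicalSpace
open Literature.Analysis.FluidPDE
open scoped NNReal ENNReal InnerProductSpace RealInnerProductSpace

/-- **Any counterexample to the core of Stub C is a local Type-I singularity** (A–B 2019, Thm 1.1 first
bullet, with `r₀ = 1`, `z = 0`): clauses (sw),(G),(I) at scale `a = 1` and a backward-singular origin give
`LocalTypeISingularityExists`.  In particular every witness against Stub C with any of (D),(R),(T),(S) or the
scales `a ≠ 1` dropped is such a singularity. [folklore; AlbrittonBarker2019 Thm 1.1 (first bullet), Def. 2.1] -/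
theorem localTypeISingularityExists_of_singular_apexCore
    {U : ℝ → EuclideanSpace ℝ (Fin 3) → EuclideanSpace ℝ (Fin 3)}
    {P : ℝ → EuclideanSpace ℝ (Fin 3) → ℝ}
    {G : ℝ → EuclideanSpace ℝ (Fin 3) → EuclideanSpace ℝ (Fin 3) →L[ℝ] EuclideanSpace ℝ (Fin 3)}
    {M : ℝ≥0}
    (hsw : IsSuitableWeakSolutionInBall 1 (0 : ℝ × EuclideanSpace ℝ (Fin 3)) U P)
    (hG : HasWeakSpatialGradientOn
      (parabolicCylinderOpens 1 (0 : ℝ × EuclideanSpace ℝ (Fin 3))) U G)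
    (hI : typeIBound (parabolicCylinder 1 (0 : ℝ × EuclideanSpace ℝ (Fin 3))) U P G ≤ M)
    (hsing : IsBackwardSingularPoint U (0 : ℝ × EuclideanSpace ℝ (Fin 3))) :
    LocalTypeISingularityExists :=
  ⟨1, 0, U, P, one_pos, hsw, hsing, G, hG, lt_of_le_of_lt hI ENNReal.coe_lt_top⟩

/-- **Stub C ⇐ «no local Type-I singularity exists»**: the statement of `stub_no_spreadExtinctApex` (seven
clauses, verbatim; only (sw),(G),(I) at `a = 1` are used) follows from `¬ LocalTypeISingularityExists`.
[folklore; AlbrittonBarker2019 Thm 1.1 (first bullet)] -/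
theorem no_spreadExtinctApex_of_not_localTypeISingularityExists (hne : ¬ LocalTypeISingularityExists) :
    ∀ (U : ℝ → EuclideanSpace ℝ (Fin 3) → EuclideanSpace ℝ (Fin 3))
      (P : ℝ → EuclideanSpace ℝ (Fin 3) → ℝ)
      (G : ℝ → EuclideanSpace ℝ (Fin 3) →
        EuclideanSpace ℝ (Fin 3) →L[ℝ] EuclideanSpace ℝ (Fin 3))
      (M D₀ : ℝ≥0) (C : ℝ),
      (∀ a : ℝ, 0 < a →
        IsSuitableWeakSolutionInBall a (0 : ℝ × EuclideanSpace ℝ (Fin 3)) U P) →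
      (∀ a : ℝ, 0 < a →
        HasWeakSpatialGradientOn
          (parabolicCylinderOpens a (0 : ℝ × EuclideanSpace ℝ (Fin 3))) U G) →
      (∀ a : ℝ, 0 < a →
        typeIBound (parabolicCylinder a (0 : ℝ × EuclideanSpace ℝ (Fin 3))) U P G ≤ M) →
      (∀ z₀ : ℝ × EuclideanSpace ℝ (Fin 3), z₀.1 ≤ 0 →
        ∀ r : ℝ, 0 < r → cknD r z₀ P ≤ D₀) →
      (∀ s : ℝ, s < 0 →
        ∀ᵐ y : EuclideanSpace ℝ (Fin 3), ‖U s y‖ ≤ C / Real.sqrt (-s)) →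
      (∀ φ : EuclideanSpace ℝ (Fin 3) → EuclideanSpace ℝ (Fin 3),
        ContDiff ℝ (⊤ : ℕ∞) φ →
        HasCompactSupport φ → ∀ ε : ℝ, 0 < ε →
        ∃ s₀ : ℝ, s₀ < 0 ∧ ∀ᵐ s ∂(volume.restrict (Ioo s₀ 0)), |∫ y, ⟪U s y, φ y⟫| ≤ ε) →
      (∀ δ : ℝ, 0 < δ → ∀ R K : ℝ,
        ¬ (∀ᵐ z ∂(volume.restrict
          (Ioo (-δ) 0 ×ˢ (closedBall (0 : EuclideanSpace ℝ (Fin 3)) R)ᶜ)), ‖U z.1 z.2‖ ≤ K)) →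
      ¬ IsBackwardSingularPoint U (0 : ℝ × EuclideanSpace ℝ (Fin 3)) :=
  fun _ _ _ M _ _ hsw hG hI _ _ _ _ hsing =>
    hne (localTypeISingularityExists_of_singular_apexCore (M := M) (hsw 1 one_pos) (hG 1 one_pos)
      (hI 1 one_pos) hsing)

end Summit.NavierStokesRegularity.NavierStokesRegularity.Theorems.TypeITraceScarL3.Negative

end
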